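import Summits.KontsevichZagierPeriods.KontsevichZagierPeriods.Theorems.BetaCancellation.Negative.DirichletCompanionStubs
import Summits.KontsevichZagierPeriods.KontsevichZagierPeriods.Theorems.BetaCancellation.Negative.LoadBearing
import Summits.KontsevichZagierPeriods.KontsevichZagierPeriods.Theorems.BetaCancellation.Negative.PiLink
import Summits.KontsevichZagierPeriods.KontsevichZagierPeriods.Theses.CompiledSubstitutions
import Literature.NumberTheory.Transcendental.GammaMonomialsProofs
import Literature.NumberTheory.Transcendental.KZRelationsLE

/-!
# `BetaCancellation` (stmt-KontsevichZagierPeriods-13633) — line `dirichlet-companion-to-pi`: the two non-explicit stubs are summit-implied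

drefute gen 3 (refuter) calibration of the two stubs of the lead's skeleton (ce846a0b) that are
NOT closed-form identities between explicit representations and were left unattacked by the
earlier generations and by the disprover's work file (`Cruxes/BetaCancellation/Disproof.lean` §16,
"not attacked here"):

* `stub_eulerReflection` = `CompiledSubstitutions.EulerReflectionRational` (item 3383):
  `∀ a ∈ ℚ ∩ (0,1)`, `[(0,1), sin(πa)·x^{a-1}(1-x)^{-a}] ∼ [{x²+y² ≤ 1}, 1]`;
* `stub_piCancellation` = `KZ.PiCancellation` (item 0540).

Findings, all sorry-free with axioms ⊆ {propext, Classical.choice, Quot.sound}: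

* §1 exact values: `sin_mul_beta_one_sub` (`sin(πa)·B(a,1-a) = π`, Euler's reflection formula
  `Γ(a)Γ(1-a) = π / sin(πa)` from Mathlib), `value_eulerRep` (the Euler representation has value
  `π` for EVERY pinned `r`), `value_discPinned` (every representation pinned as the closed unit
  disc with integrand `1` has value `π`).
* §2 IRREFUTABILITY: `stubEulerReflection_of_kernel`, `stubEulerReflection_of_summit` —
  `KontsevichZagierPeriods → EulerReflectionRational`; `stubPiCancellation_of_summit` —
  `KontsevichZagierPeriods → KZ.PiCancellation` (soundness `KZ.relations_le_ker_eval_holds` +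
  `KZ.piCancellation_of_kernel`). With `DirichletCompanionStubs.lean` (the four explicit stubs)
  EVERY stub of the line is a consequence of the summit: no stub-false finding can exist short of
  `¬ KontsevichZagierPeriods`; and `stub_piCancellation` is also NECESSARY
  (`piCancellation_of_betaCancellation`, `PiLink.lean`).
* §3 NON-VACUITY and a PROVED INSTANCE: `exists_eulerRep` (the pinned Euler representation exists
  for every rational `0 < a < 1`: Mellin integrand `(X₀, 1-X₀)^{(a-1,-a)}` scaled by the algebraic
  constant `sin(πa)`; no new definitions), and `stubEulerReflection_half` — the instance `a = 1/2` of the stub HOLDS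
  unconditionally (`sin(π/2) = 1`; `[β(1/2,1/2)] ∼ [π]` is the disprover's four-move chain
  `equivalent_betaHalfRep_piRep`). So on the half-integer column `b ∈ 1/2 + ℕ` the line needs
  only `stub_piCancellation`.
* §4 SHARPNESS of the guards `0 < a`, `a < 1` (hypothesis mutation): weakened to `0 ≤ a`
  (resp. `a ≤ 1`) the stub is FALSE at `a = 0` (resp. `a = 1`): `sin(πa) = 0` makes the pinned
  integrand the zero function, so `r = [(0,1), 0]` (value `0`) would be equivalent to `[π]`
  (value `π`), contradicting soundness. Both guards are load-bearing, not mere non-vacuity guards.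

References: Kontsevich–Zagier 2001 §1.1–1.2; Andrews–Askey–Roy 1999, Thm 1.2.1 (reflection);
Huber–Wüstholz 2022, App. A (status of `π`-cancellation); this project's `KZProduct.lean`,
`Negative/KernelForm.lean`, `Negative/PiLink.lean`.
-/

noncomputable section

set_option linter.dupNamespace false

namespace Summit.KontsevichZagierPeriods.KontsevichZagierPeriods.BetaCancellationNegative

open MeasureTheory Set
open Literature.NumberTheory.Transcendental
open Literature.NumberTheory.Transcendental.KZ
open Literature.NumberTheory.Transcendental.KZreg (unitIoo isSemialgebraic_unitIoo)
open MvPolynomial (X)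
open Summit.KontsevichZagierPeriods.KontsevichZagierPeriods.Theses.CompiledSubstitutions
  (EulerReflectionRational)

/-! ## §1 Exact values -/

/-- **Euler reflection at the level of values**: `sin(πa)·B(a,1-a) = π` for `0 < a < 1`
(`B(a,1-a) = Γ(a)Γ(1-a)/Γ(1) = π / sin(πa)`). [folklore] -/
theorem sin_mul_beta_one_sub {a : ℝ} (ha : 0 < a) (ha1 : a < 1) :
    Real.sin (Real.pi * a) * ProbabilityTheory.beta a (1 - a) = Real.pi := by
  have hsin : Real.sin (Real.pi * a) ≠ 0 := by
    refine (Real.sin_pos_of_pos_of_lt_pi (by positivity) ?_).ne'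
    nlinarith [Real.pi_pos]
  simp only [ProbabilityTheory.beta]
  rw [show a + (1 - a) = 1 by ring, Real.Gamma_one, div_one, Real.Gamma_mul_Gamma_one_sub]
  field_simp

/-- **Value of the pinned Euler representation** `r = [(0,1), sin(πa) x^{a-1}(1-x)^{-a}]`: `π`,
for every `r` satisfying the two pins of the stub. [folklore] -/
theorem value_eulerRep {a : ℚ} (ha : 0 < a) (ha1 : a < 1) (r : IntegralRep 1)
    (hrd : r.domain = {x | x 0 ∈ Set.Ioo (0:ℝ) 1})
    (hri : Set.EqOn r.integrand (fun x => Real.sin (Real.pi * a) * (x 0) ^ ((a : ℝ) - 1) *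
      (1 - x 0) ^ (-(a : ℝ))) r.domain) :
    r.value = Real.pi := by
  have hmeas : MeasurableSet r.domain := IntegralRep.measurableSet_domain_holds r
  rw [IntegralRep.value, setIntegral_congr_fun hmeas hri, hrd,
    setIntegral_coord0 (fun t => Real.sin (Real.pi * a) * t ^ ((a : ℝ) - 1) * (1 - t) ^ (-(a : ℝ)))]
  have h1a : 0 < 1 - a := by linarith
  have hB := integral_kernel_eq_beta ha h1a
  push_cast at hB
  have e : (1:ℝ) - a - 1 = -(a:ℝ) := by ring
  rw [e] at hB
  simp_rw [mul_assoc]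
  rw [integral_const_mul, hB]
  exact sin_mul_beta_one_sub (by exact_mod_cast ha) (by exact_mod_cast ha1)

/-- **Value of a representation pinned as the closed unit disc with integrand `1`**: `π`.
[folklore] -/
theorem value_discPinned (p : IntegralRep 2) (hpd : p.domain = {z | z 0 ^ 2 + z 1 ^ 2 ≤ 1})
    (hpi : Set.EqOn p.integrand (fun _ => 1) p.domain) : p.value = Real.pi := by
  have hmeas : MeasurableSet p.domain := IntegralRep.measurableSet_domain_holds p
  rw [IntegralRep.value, setIntegral_congr_fun hmeas hpi, hpd]
  change ∫ _ in piDisc, (1:ℝ) = Real.pi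
  rw [setIntegral_const, measureReal_def, volume_piDisc, ENNReal.toReal_ofReal Real.pi_pos.le,
    smul_eq_mul, mul_one]

/-! ## §2 The two stubs are summit-implied -/

/-- Kernel conjecture ⇒ `stub_eulerReflection` (= `EulerReflectionRational`, item 3383). [folklore] -/
theorem stubEulerReflection_of_kernel (hK : KZKernelConjecture) : EulerReflectionRational := by
  intro a ha ha1 r p hrd hri hpd hpi
  apply hK
  rw [KZ.eval_of_sub_of, value_eulerRep ha ha1 r hrd hri, value_discPinned p hpd hpi, sub_self]

/-- **Summit ⇒ `stub_eulerReflection`**: the stub is irrefutable short of refuting the summit.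
[folklore] -/
theorem stubEulerReflection_of_summit (h : _root_.KontsevichZagierPeriods) : EulerReflectionRational :=
  stubEulerReflection_of_kernel (kzKernelConjecture_iff_isRational.2 h)

/-- **Summit ⇒ `stub_piCancellation`** (= `KZ.PiCancellation`, item 0540): soundness of the moves
plus the kernel conjecture (`KZ.piCancellation_of_kernel`). Together with
`piCancellation_of_betaCancellation` (`PiLink.lean`) the stub is both summit-implied and necessary
for the crux. [folklore] -/
theorem stubPiCancellation_of_summit (h : _root_.KontsevichZagierPeriods) : KZ.PiCancellation :=
  piCancellation_of_kernel relations_le_ker_eval_holds (kzKernelConjecture_iff_isRational.2 h)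

/-! ## §3 Non-vacuity, and the proved instance `a = 1/2` -/

/-- `sin(πa)` is algebraic for rational `a > 0`. [folklore] -/
theorem isAlgebraic_sin_pi_mul_rat {a : ℚ} (ha : 0 < a) : IsAlgebraic ℚ (Real.sin (Real.pi * a)) := by
  have h := KoblitzOgus.isAlgebraic_sin_rat_mul_pi a.num.toNat a.den_pos
  have hn : ((a.num.toNat : ℕ) : ℝ) = ((a.num : ℤ) : ℝ) := by
    have := Int.toNat_of_nonneg (Rat.num_nonneg.2 ha.le)
    exact_mod_cast this
  have hcast : (Real.pi * (a.num.toNat : ℕ) / (a.den : ℕ) : ℝ) = Real.pi * a := by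
    rw [mul_div_assoc, hn, ← Rat.cast_def]
  rwa [hcast] at h

/-- **The pinned Euler representation exists** for every rational `0 < a < 1`: the hypotheses of
`stub_eulerReflection` are satisfiable (no vacuity).  Witness: the Euler–Mellin integrand of the
family `(X₀, 1 − X₀)` with exponents `(a−1, −a)` on `(0,1)` (semialgebraic by
`isSemialgebraicFunOn_mellinIntegrand`, integrable by Mathlib's Beta density), scaled by the
algebraic constant `sin(πa)`. [folklore] -/
theorem exists_eulerRep {a : ℚ} (ha : 0 < a) (ha1 : a < 1) :
    ∃ r : IntegralRep 1, r.domain = {x | x 0 ∈ Set.Ioo (0:ℝ) 1} ∧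
      Set.EqOn r.integrand (fun x => Real.sin (Real.pi * a) * (x 0) ^ ((a : ℝ) - 1) *
        (1 - x 0) ^ (-(a : ℝ))) r.domain := by
  have h1a : 0 < 1 - a := by linarith
  have hsa : IsSemialgebraicFunOn ℚ unitIoo (fun x : Fin 1 → ℝ => betaKernel a (1 - a) (x 0)) := by
    refine (isSemialgebraicFunOn_mellinIntegrand isSemialgebraic_unitIoo ![X 0, 1 - X 0]
      ![a - 1, (1 - a) - 1] 1 (fun x hx k => ?_)).congr fun x _ => ?_
    · simp only [mem_unitIoo, mem_Ioo] at hx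
      fin_cases k <;> simp [hx.1, hx.2]
    · simp [mellinIntegrand, betaKernel, Fin.prod_univ_two]
  let β : IntegralRep 1 :=
    { domain := unitIoo
      integrand := fun x => betaKernel a (1 - a) (x 0)
      isSemialgebraic_domain := isSemialgebraic_unitIoo
      isSemialgebraicFunOn_integrand := hsa
      integrableOn :=
        integrableOn_comp_apply_zero_iff.2 (integrableOn_betaKernel_and_integral_eq ha h1a).1 }
  refine ⟨β.constMul (Real.sin (Real.pi * a)) (isAlgebraic_sin_pi_mul_rat ha), rfl, fun x _ => ?_⟩
  simp only [IntegralRep.integrand_constMul, β, betaKernel]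
  push_cast
  ring_nf

/-- **The instance `a = 1/2` of `stub_eulerReflection` HOLDS unconditionally**: `sin(π/2) = 1`, so
the pinned `r` agrees with `[β(1/2,1/2)]` on its domain, `[β(1/2,1/2)] ∼ [π]`
(`equivalent_betaHalfRep_piRep`, four moves), and `[π]` agrees with the pinned `p`. [folklore] -/
theorem stubEulerReflection_half (r : IntegralRep 1) (p : IntegralRep 2)
    (hrd : r.domain = {x | x 0 ∈ Set.Ioo (0:ℝ) 1})
    (hri : Set.EqOn r.integrand (fun x => Real.sin (Real.pi * ((1/2 : ℚ) : ℝ)) *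
      (x 0) ^ (((1/2 : ℚ) : ℝ) - 1) * (1 - x 0) ^ (-((1/2 : ℚ) : ℝ))) r.domain)
    (hpd : p.domain = {z | z 0 ^ 2 + z 1 ^ 2 ≤ 1})
    (hpi : Set.EqOn p.integrand (fun _ => 1) p.domain) :
    Equivalent r p := by
  have hsin : Real.sin (Real.pi * ((1/2 : ℚ) : ℝ)) = 1 := by
    rw [show (Real.pi * ((1/2 : ℚ) : ℝ) : ℝ) = Real.pi / 2 by push_cast; ring, Real.sin_pi_div_two]
  have h1 : Equivalent r betaHalfRep := by
    refine of_sub_of_mem_relations_of_eqOn (by rw [hrd]; rfl) fun x hx => ?_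
    rw [hri hx, betaHalfRep_integrand]
    simp only [hsin, one_mul, betaKernel]
    push_cast
    norm_num
  have h2 : Equivalent piRep p := by
    refine of_sub_of_mem_relations_of_eqOn (by rw [hpd]; rfl) fun z hz => ?_
    rw [piRep_integrand]
    exact (hpi (by rw [hpd]; exact hz)).symm
  exact (h1.trans equivalent_betaHalfRep_piRep).trans h2

/-! ## §4 Sharpness of the guards `0 < a` and `a < 1` -/

/-- **The guard `0 < a` of `stub_eulerReflection` is sharp**: weakened to `0 ≤ a` the stub FAILS
at `a = 0` (`sin 0 = 0`: `r = [(0,1), 0]`, value `0`, versus `[π]`, value `π`). [folklore] -/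
theorem stubEulerReflection_false_without_pos :
    ¬ (∀ a : ℚ, 0 ≤ a → a < 1 → ∀ (r : IntegralRep 1) (p : IntegralRep 2),
        r.domain = {x | x 0 ∈ Set.Ioo (0:ℝ) 1} →
        Set.EqOn r.integrand (fun x => Real.sin (Real.pi * a) * (x 0) ^ ((a : ℝ) - 1) *
          (1 - x 0) ^ (-(a : ℝ))) r.domain →
        p.domain = {z | z 0 ^ 2 + z 1 ^ 2 ≤ 1} → Set.EqOn p.integrand (fun _ => 1) p.domain →
        Equivalent r p) := by
  intro h
  have hr : Set.EqOn (polyKernelRep 0).integrand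
      (fun x => Real.sin (Real.pi * ((0:ℚ) : ℝ)) * (x 0) ^ (((0:ℚ) : ℝ) - 1) *
        (1 - x 0) ^ (-((0:ℚ) : ℝ))) (polyKernelRep 0).domain := by
    intro x _
    simp
  have heq := h 0 le_rfl one_pos (polyKernelRep 0) piRep rfl hr rfl (fun _ _ => rfl)
  have hv := Equivalent.value_eq_holds heq
  rw [value_polyKernelRep_zero, piRep_value] at hv
  exact Real.pi_ne_zero hv.symm

/-- **The guard `a < 1` of `stub_eulerReflection` is sharp**: weakened to `a ≤ 1` the stub FAILS
at `a = 1` (`sin π = 0`: `r = [(0,1), 0]`, value `0`, versus `[π]`, value `π`). [folklore] -/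
theorem stubEulerReflection_false_without_lt_one :
    ¬ (∀ a : ℚ, 0 < a → a ≤ 1 → ∀ (r : IntegralRep 1) (p : IntegralRep 2),
        r.domain = {x | x 0 ∈ Set.Ioo (0:ℝ) 1} →
        Set.EqOn r.integrand (fun x => Real.sin (Real.pi * a) * (x 0) ^ ((a : ℝ) - 1) *
          (1 - x 0) ^ (-(a : ℝ))) r.domain →
        p.domain = {z | z 0 ^ 2 + z 1 ^ 2 ≤ 1} → Set.EqOn p.integrand (fun _ => 1) p.domain →
        Equivalent r p) := by
  intro h
  have hr : Set.EqOn (polyKernelRep 0).integrand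
      (fun x => Real.sin (Real.pi * ((1:ℚ) : ℝ)) * (x 0) ^ (((1:ℚ) : ℝ) - 1) *
        (1 - x 0) ^ (-((1:ℚ) : ℝ))) (polyKernelRep 0).domain := by
    intro x _
    simp [Real.sin_pi]
  have heq := h 1 one_pos le_rfl (polyKernelRep 0) piRep rfl hr rfl (fun _ _ => rfl)
  have hv := Equivalent.value_eq_holds heq
  rw [value_polyKernelRep_zero, piRep_value] at hv
  exact Real.pi_ne_zero hv.symm

end Summit.KontsevichZagierPeriods.KontsevichZagierPeriods.BetaCancellationNegative
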